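import Mathlib
import HarnessLib
import Literature.Computability.AlgebraicComplexity.ArithCircuit
import Literature.Computability.AlgebraicComplexity.ArithCircuitProofs
import Literature.NumberTheory.Automorphic.HeckeLatticeCount

/-!
# ValiantsHypothesis / MonotoneRestoration — `MonotoneRestorationQP`, line `Sketch`, stub G4

Support file for crux item `stmt-ValiantsHypothesis-15886`
(`Summit.ValiantsHypothesis.ValiantsHypothesis.Theses.MonotoneRestoration.MonotoneRestorationQP`),
line `Sketch`, stub `stub_esymmRowSums_complexity`: the witness of Theorem γ,
`E_n = e_{⌊n/2⌋}(R₁, …, R_n)` — the elementary symmetric polynomial of degree `⌊n/2⌋` in the row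
sums `R_i = Σ_j x_{ij}` of the `n × n` matrix of variables, over the semiring `ℝ≥0` — is
*monotone-easy*: its fan-in-two circuit complexity over `ℝ≥0` (tree `complexity`) is at most
`(n + 2) ^ 3`.

## Proof

A monotone straight-line program with sharing (a monotone *formula* would not do: monotone
formulas for `e_d` have size `n^{Θ(log d)}`):

* row sums: each `R_i` is built by `n + 1` fan-in-`≤ 2` sum gates (`0`, then `+ x_{i j}` one
  variable at a time), `n (n + 1)` gates in total;
* the prefix dynamic programme: with `d = ⌊n/2⌋`, process the rows one at a time keeping gates for
  `e_0, …, e_d` of the rows processed so far; the start is `e_0 = 1`, `e_t = 0` (`t > 0`, two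
  gates), and adding a row `a` costs `2 d` gates by the recursion
  `e_{t+1}(a ∷ s) = e_{t+1}(s) + a · e_t(s)` (one product and one sum gate per `t`).

Total `n (n + 1) + 2 + 2 d n ≤ 2 n² + n + 2 ≤ (n + 2)³` gates, and `complexity_le_size`.

The bookkeeping is phrased without any new definition: a gate list `gs` *provides* a polynomial
`p` when `p ∈ gateValues gs`; appending gates keeps provided polynomials provided
(`esymmRowSumsCplx_mem_of_prefix`), and each elementary step appends one fan-in-`≤ 2` gate
(`esymmRowSumsCplx_step_add`, `_step_mul`, `_step_addX`, `_step_zero`, `_step_one`). The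
elementary symmetric functions of the rows processed so far are Mathlib's `Multiset.esymm` of the
multiset of row sums, identified with `bind₁ R (MvPolynomial.esymm (Fin n) ℝ≥0 d)` by
`MvPolynomial.aeval_esymm_eq_multiset_esymm`; the recursion `e_{t+1}(a ∷ s) = e_{t+1}(s) + a e_t(s)`
and `e_0 = 1`, `e_t(∅) = 0` (`t > 0`) are the tree's
`Literature.NumberTheory.Automorphic.multiset_esymm_cons_succ` / `multiset_esymm_zero_right` /
`multiset_esymm_eq_zero_of_card_lt` (`HeckeLatticeCount.lean`, imported for exactly these).

## References

* M. Jerrum, M. Snir, *Some exact complexity results for straight-line computations over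
  semirings*, J. ACM 29 (1982), §2 (elementary symmetric functions).
* P. Bürgisser, *Completeness and Reduction in Algebraic Complexity Theory*, Springer 2000,
  Def. 2.1.
-/

-- `Summit.ValiantsHypothesis.ValiantsHypothesis.…` is the tree's mandated single-conjunct layout
-- (Sub = Summit), so the duplicated namespace component is intended.
set_option linter.dupNamespace false

noncomputable section

namespace Summit.ValiantsHypothesis.ValiantsHypothesis.Theorems

open Literature.Computability.AlgebraicComplexity Literature.NumberTheory.Automorphic MvPolynomial
open scoped NNReal

variable {k : Type*} [CommSemiring k] {σ : Type*}

/-! ### Straight-line programs: appending gates -/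

/-- Appending gates does not change the values of the earlier gates: the old value list is a
prefix of the new one (Bürgisser 2000, Def. 2.1). [folklore] -/
theorem esymmRowSumsCplx_gateValues_prefix (gs gs' : List (ArithCircuit.Gate k σ)) :
    ArithCircuit.gateValues gs <+: ArithCircuit.gateValues (gs ++ gs') := by
  induction gs' using List.reverseRecOn with
  | nil => simp
  | append_singleton gs' g ih =>
    rw [← List.append_assoc, ArithCircuit.gateValues_append_singleton]
    exact ih.trans (List.prefix_append _ _)

/-- A polynomial provided by a gate list is still provided after appending gates. [folklore] -/
theorem esymmRowSumsCplx_mem_of_prefix {gs gs' : List (ArithCircuit.Gate k σ)}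
    (h : gs <+: gs') {p : MvPolynomial σ k} (hp : p ∈ ArithCircuit.gateValues gs) :
    p ∈ ArithCircuit.gateValues gs' := by
  obtain ⟨ws, rfl⟩ := h
  exact (esymmRowSumsCplx_gateValues_prefix gs ws).sublist.subset hp

/-- A value occurring in the value list is read by some gate operand. [folklore] -/
theorem esymmRowSumsCplx_exists_getD {vals : List (MvPolynomial σ k)} {p : MvPolynomial σ k}
    (hp : p ∈ vals) : ∃ j : ℕ, vals.getD j 0 = p := by
  obtain ⟨i, hi, rfl⟩ := List.getElem_of_mem hp
  exact ⟨i, by rw [List.getD_eq_getElem?_getD, List.getElem?_eq_getElem hi, Option.getD_some]⟩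

/-- One sum gate `u + v` of fan-in two: if `p` and `q` are provided, one more gate provides
`p + q`. [folklore] -/
theorem esymmRowSumsCplx_step_add {gs : List (ArithCircuit.Gate k σ)}
    (hfan : ∀ g ∈ gs, g.fanIn ≤ 2) {p q : MvPolynomial σ k}
    (hp : p ∈ ArithCircuit.gateValues gs) (hq : q ∈ ArithCircuit.gateValues gs) :
    ∃ gs' : List (ArithCircuit.Gate k σ), gs <+: gs' ∧ (∀ g ∈ gs', g.fanIn ≤ 2) ∧
      gs'.length = gs.length + 1 ∧ p + q ∈ ArithCircuit.gateValues gs' := by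
  obtain ⟨a, ha⟩ := esymmRowSumsCplx_exists_getD hp
  obtain ⟨b, hb⟩ := esymmRowSumsCplx_exists_getD hq
  refine ⟨gs ++ [.sum [(1, .gate a), (1, .gate b)]], List.prefix_append _ _, ?_, by simp, ?_⟩
  · intro g hg
    rw [List.mem_append, List.mem_singleton] at hg
    rcases hg with hg | rfl
    · exact hfan g hg
    · simp [ArithCircuit.Gate.fanIn, ArithCircuit.Gate.args]
  · have hval : (ArithCircuit.Gate.sum [(1, .gate a), (1, .gate b)] : ArithCircuit.Gate k σ).eval
        (ArithCircuit.gateValues gs) = p + q := by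
      simp only [ArithCircuit.Gate.eval, ArithCircuit.Operand.eval, List.map_cons, List.map_nil,
        List.sum_cons, List.sum_nil, one_smul, add_zero, ha, hb]
    rw [ArithCircuit.gateValues_append_singleton, hval]
    exact List.mem_append_right _ (List.mem_singleton_self _)

/-- One product gate `u * v` of fan-in two: if `p` and `q` are provided, one more gate provides
`p * q`. [folklore] -/
theorem esymmRowSumsCplx_step_mul {gs : List (ArithCircuit.Gate k σ)}
    (hfan : ∀ g ∈ gs, g.fanIn ≤ 2) {p q : MvPolynomial σ k}
    (hp : p ∈ ArithCircuit.gateValues gs) (hq : q ∈ ArithCircuit.gateValues gs) :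
    ∃ gs' : List (ArithCircuit.Gate k σ), gs <+: gs' ∧ (∀ g ∈ gs', g.fanIn ≤ 2) ∧
      gs'.length = gs.length + 1 ∧ p * q ∈ ArithCircuit.gateValues gs' := by
  obtain ⟨a, ha⟩ := esymmRowSumsCplx_exists_getD hp
  obtain ⟨b, hb⟩ := esymmRowSumsCplx_exists_getD hq
  refine ⟨gs ++ [.prod [.gate a, .gate b]], List.prefix_append _ _, ?_, by simp, ?_⟩
  · intro g hg
    rw [List.mem_append, List.mem_singleton] at hg
    rcases hg with hg | rfl
    · exact hfan g hg
    · simp [ArithCircuit.Gate.fanIn, ArithCircuit.Gate.args]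
  · have hval : (ArithCircuit.Gate.prod [.gate a, .gate b] : ArithCircuit.Gate k σ).eval
        (ArithCircuit.gateValues gs) = p * q := by
      simp only [ArithCircuit.Gate.eval, ArithCircuit.Operand.eval, List.map_cons, List.map_nil,
        List.prod_cons, List.prod_nil, mul_one, ha, hb]
    rw [ArithCircuit.gateValues_append_singleton, hval]
    exact List.mem_append_right _ (List.mem_singleton_self _)

/-- One sum gate `u + X x` of fan-in two: if `p` is provided, one more gate provides `p + X x`.
[folklore] -/
theorem esymmRowSumsCplx_step_addX {gs : List (ArithCircuit.Gate k σ)}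
    (hfan : ∀ g ∈ gs, g.fanIn ≤ 2) {p : MvPolynomial σ k}
    (hp : p ∈ ArithCircuit.gateValues gs) (x : σ) :
    ∃ gs' : List (ArithCircuit.Gate k σ), gs <+: gs' ∧ (∀ g ∈ gs', g.fanIn ≤ 2) ∧
      gs'.length = gs.length + 1 ∧ p + X x ∈ ArithCircuit.gateValues gs' := by
  obtain ⟨a, ha⟩ := esymmRowSumsCplx_exists_getD hp
  refine ⟨gs ++ [.sum [(1, .gate a), (1, .var x)]], List.prefix_append _ _, ?_, by simp, ?_⟩
  · intro g hg
    rw [List.mem_append, List.mem_singleton] at hg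
    rcases hg with hg | rfl
    · exact hfan g hg
    · simp [ArithCircuit.Gate.fanIn, ArithCircuit.Gate.args]
  · have hval : (ArithCircuit.Gate.sum [(1, .gate a), (1, .var x)] : ArithCircuit.Gate k σ).eval
        (ArithCircuit.gateValues gs) = p + X x := by
      simp only [ArithCircuit.Gate.eval, ArithCircuit.Operand.eval, List.map_cons, List.map_nil,
        List.sum_cons, List.sum_nil, one_smul, add_zero, ha]
    rw [ArithCircuit.gateValues_append_singleton, hval]
    exact List.mem_append_right _ (List.mem_singleton_self _)

/-- The empty sum gate (fan-in zero) provides `0`. [folklore] -/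
theorem esymmRowSumsCplx_step_zero {gs : List (ArithCircuit.Gate k σ)}
    (hfan : ∀ g ∈ gs, g.fanIn ≤ 2) :
    ∃ gs' : List (ArithCircuit.Gate k σ), gs <+: gs' ∧ (∀ g ∈ gs', g.fanIn ≤ 2) ∧
      gs'.length = gs.length + 1 ∧ (0 : MvPolynomial σ k) ∈ ArithCircuit.gateValues gs' := by
  refine ⟨gs ++ [.sum []], List.prefix_append _ _, ?_, by simp, ?_⟩
  · intro g hg
    rw [List.mem_append, List.mem_singleton] at hg
    rcases hg with hg | rfl
    · exact hfan g hg
    · simp [ArithCircuit.Gate.fanIn, ArithCircuit.Gate.args]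
  · have hval : (ArithCircuit.Gate.sum [] : ArithCircuit.Gate k σ).eval
        (ArithCircuit.gateValues gs) = 0 := by
      simp only [ArithCircuit.Gate.eval, List.map_nil, List.sum_nil]
    rw [ArithCircuit.gateValues_append_singleton, hval]
    exact List.mem_append_right _ (List.mem_singleton_self _)

/-- The empty product gate (fan-in zero) provides `1`. [folklore] -/
theorem esymmRowSumsCplx_step_one {gs : List (ArithCircuit.Gate k σ)}
    (hfan : ∀ g ∈ gs, g.fanIn ≤ 2) :
    ∃ gs' : List (ArithCircuit.Gate k σ), gs <+: gs' ∧ (∀ g ∈ gs', g.fanIn ≤ 2) ∧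
      gs'.length = gs.length + 1 ∧ (1 : MvPolynomial σ k) ∈ ArithCircuit.gateValues gs' := by
  refine ⟨gs ++ [.prod []], List.prefix_append _ _, ?_, by simp, ?_⟩
  · intro g hg
    rw [List.mem_append, List.mem_singleton] at hg
    rcases hg with hg | rfl
    · exact hfan g hg
    · simp [ArithCircuit.Gate.fanIn, ArithCircuit.Gate.args]
  · have hval : (ArithCircuit.Gate.prod [] : ArithCircuit.Gate k σ).eval
        (ArithCircuit.gateValues gs) = 1 := by
      simp only [ArithCircuit.Gate.eval, List.map_nil, List.prod_nil]
    rw [ArithCircuit.gateValues_append_singleton, hval]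
    exact List.mem_append_right _ (List.mem_singleton_self _)

/-! ### Row sums -/

/-- A sum of variables `Σ_{i ∈ s} X (x i)` is provided by `#s + 1` more fan-in-`≤ 2` gates
(`0`, then one variable at a time). [folklore] -/
theorem esymmRowSumsCplx_rowSum {ι : Type*} (x : ι → σ) (s : Finset ι) :
    ∀ gs : List (ArithCircuit.Gate k σ), (∀ g ∈ gs, g.fanIn ≤ 2) →
      ∃ gs' : List (ArithCircuit.Gate k σ), gs <+: gs' ∧ (∀ g ∈ gs', g.fanIn ≤ 2) ∧
        gs'.length = gs.length + (s.card + 1) ∧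
        (∑ i ∈ s, X (x i) : MvPolynomial σ k) ∈ ArithCircuit.gateValues gs' := by
  classical
  induction s using Finset.induction_on with
  | empty =>
    intro gs hfan
    obtain ⟨gs₁, hpre₁, hfan₁, hlen₁, hmem₁⟩ := esymmRowSumsCplx_step_zero hfan
    exact ⟨gs₁, hpre₁, hfan₁, by rw [hlen₁, Finset.card_empty], by rwa [Finset.sum_empty]⟩
  | insert a s ha ih =>
    intro gs hfan
    obtain ⟨gs₁, hpre₁, hfan₁, hlen₁, hmem₁⟩ := ih gs hfan
    obtain ⟨gs₂, hpre₂, hfan₂, hlen₂, hmem₂⟩ := esymmRowSumsCplx_step_addX hfan₁ hmem₁ (x a)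
    refine ⟨gs₂, hpre₁.trans hpre₂, hfan₂, ?_, ?_⟩
    · rw [hlen₂, hlen₁, Finset.card_insert_of_notMem ha]; omega
    · rw [Finset.sum_insert ha, add_comm]; exact hmem₂

/-- All the row sums `Σ_{j ∈ T} X (x i j)`, `i ∈ S`, are provided by `#S (#T + 1)` more
fan-in-`≤ 2` gates. [folklore] -/
theorem esymmRowSumsCplx_allRows {ι κ : Type*} (x : ι → κ → σ) (T : Finset κ) (S : Finset ι) :
    ∀ gs : List (ArithCircuit.Gate k σ), (∀ g ∈ gs, g.fanIn ≤ 2) →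
      ∃ gs' : List (ArithCircuit.Gate k σ), gs <+: gs' ∧ (∀ g ∈ gs', g.fanIn ≤ 2) ∧
        gs'.length = gs.length + S.card * (T.card + 1) ∧
        ∀ i ∈ S, (∑ j ∈ T, X (x i j) : MvPolynomial σ k) ∈ ArithCircuit.gateValues gs' := by
  classical
  induction S using Finset.induction_on with
  | empty =>
    intro gs hfan
    exact ⟨gs, List.prefix_rfl, hfan, by simp, fun i hi => absurd hi (Finset.notMem_empty i)⟩
  | insert a S ha ih =>
    intro gs hfan
    obtain ⟨gs₁, hpre₁, hfan₁, hlen₁, hmem₁⟩ := ih gs hfan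
    obtain ⟨gs₂, hpre₂, hfan₂, hlen₂, hmem₂⟩ := esymmRowSumsCplx_rowSum (x a) T gs₁ hfan₁
    refine ⟨gs₂, hpre₁.trans hpre₂, hfan₂, ?_, ?_⟩
    · rw [hlen₂, hlen₁, Finset.card_insert_of_notMem ha, Nat.succ_mul]; omega
    · intro i hi
      rw [Finset.mem_insert] at hi
      rcases hi with rfl | hi
      · exact hmem₂
      · exact esymmRowSumsCplx_mem_of_prefix hpre₂ (hmem₁ i hi)

/-! ### The prefix dynamic programme -/

/-- One row of the dynamic programme: if `a` and `e_0(s), …, e_d(s)` are provided then, for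
`d' ≤ d`, `2 d'` more fan-in-`≤ 2` gates provide `e_0(a ∷ s), …, e_{d'}(a ∷ s)`
(`e_0(a ∷ s) = e_0(s) = 1`, `e_{t+1}(a ∷ s) = e_{t+1}(s) + a · e_t(s)`; Jerrum–Snir 1982, §2).
[folklore] -/
theorem esymmRowSumsCplx_dpRow (d : ℕ) (a : MvPolynomial σ k) (s : Multiset (MvPolynomial σ k))
    {gs : List (ArithCircuit.Gate k σ)} (hfan : ∀ g ∈ gs, g.fanIn ≤ 2)
    (ha : a ∈ ArithCircuit.gateValues gs) (hs : ∀ t ≤ d, s.esymm t ∈ ArithCircuit.gateValues gs) :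
    ∀ d' ≤ d, ∃ gs' : List (ArithCircuit.Gate k σ), gs <+: gs' ∧ (∀ g ∈ gs', g.fanIn ≤ 2) ∧
      gs'.length = gs.length + 2 * d' ∧
      ∀ t ≤ d', (a ::ₘ s).esymm t ∈ ArithCircuit.gateValues gs' := by
  intro d'
  induction d' with
  | zero =>
    intro _
    refine ⟨gs, List.prefix_rfl, hfan, by simp, fun t ht => ?_⟩
    obtain rfl : t = 0 := Nat.le_zero.mp ht
    rw [multiset_esymm_zero_right, ← multiset_esymm_zero_right s]
    exact hs 0 (Nat.zero_le d)
  | succ d' ih =>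
    intro hd
    have hd' : d' ≤ d := Nat.le_of_succ_le hd
    obtain ⟨gs₁, hpre₁, hfan₁, hlen₁, hmem₁⟩ := ih hd'
    obtain ⟨gs₂, hpre₂, hfan₂, hlen₂, hmem₂⟩ := esymmRowSumsCplx_step_mul hfan₁
      (esymmRowSumsCplx_mem_of_prefix hpre₁ ha) (esymmRowSumsCplx_mem_of_prefix hpre₁ (hs d' hd'))
    obtain ⟨gs₃, hpre₃, hfan₃, hlen₃, hmem₃⟩ := esymmRowSumsCplx_step_add hfan₂
      (esymmRowSumsCplx_mem_of_prefix (hpre₁.trans hpre₂) (hs (d' + 1) hd)) hmem₂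
    refine ⟨gs₃, hpre₁.trans (hpre₂.trans hpre₃), hfan₃, by omega, fun t ht => ?_⟩
    rcases Nat.lt_or_eq_of_le ht with h | rfl
    · exact esymmRowSumsCplx_mem_of_prefix (hpre₂.trans hpre₃) (hmem₁ t (Nat.lt_succ_iff.mp h))
    · rw [multiset_esymm_cons_succ]
      exact hmem₃

/-- The prefix dynamic programme: if every element of the multiset `s` of polynomials is
provided, then `2 + 2 d · card s` more fan-in-`≤ 2` gates provide `e_0(s), …, e_d(s)`
(start `e_0(∅) = 1`, `e_{t+1}(∅) = 0`; one row at a time by `esymmRowSumsCplx_dpRow`;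
Jerrum–Snir 1982, §2). [folklore] -/
theorem esymmRowSumsCplx_dp (d : ℕ) (s : Multiset (MvPolynomial σ k)) :
    ∀ gs : List (ArithCircuit.Gate k σ), (∀ g ∈ gs, g.fanIn ≤ 2) →
      (∀ p ∈ s, p ∈ ArithCircuit.gateValues gs) →
      ∃ gs' : List (ArithCircuit.Gate k σ), gs <+: gs' ∧ (∀ g ∈ gs', g.fanIn ≤ 2) ∧
        gs'.length ≤ gs.length + 2 + 2 * d * Multiset.card s ∧
        ∀ t ≤ d, s.esymm t ∈ ArithCircuit.gateValues gs' := by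
  induction s using Multiset.induction_on with
  | empty =>
    intro gs hfan _
    obtain ⟨gs₁, hpre₁, hfan₁, hlen₁, hmem₁⟩ := esymmRowSumsCplx_step_zero hfan
    obtain ⟨gs₂, hpre₂, hfan₂, hlen₂, hmem₂⟩ := esymmRowSumsCplx_step_one hfan₁
    refine ⟨gs₂, hpre₁.trans hpre₂, hfan₂, by rw [Multiset.card_zero]; omega, fun t _ => ?_⟩
    cases t with
    | zero => rw [multiset_esymm_zero_right]; exact hmem₂
    | succ t =>
      rw [multiset_esymm_eq_zero_of_card_lt 0 (by simp)]
      exact esymmRowSumsCplx_mem_of_prefix hpre₂ hmem₁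
  | cons a s ih =>
    intro gs hfan hmem
    obtain ⟨gs₁, hpre₁, hfan₁, hlen₁, hmem₁⟩ :=
      ih gs hfan fun p hp => hmem p (Multiset.mem_cons_of_mem hp)
    obtain ⟨gs₂, hpre₂, hfan₂, hlen₂, hmem₂⟩ := esymmRowSumsCplx_dpRow d a s hfan₁
      (esymmRowSumsCplx_mem_of_prefix hpre₁ (hmem a (Multiset.mem_cons_self a s))) hmem₁ d le_rfl
    refine ⟨gs₂, hpre₁.trans hpre₂, hfan₂, ?_, hmem₂⟩
    rw [Multiset.card_cons, Nat.mul_succ]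
    omega

/-! ### The stub -/

/-- **G4 — the witness is monotone-easy**: `e_{⌊n/2⌋}` of the row sums has monotone (`ℝ≥0`)
fan-in-two complexity `≤ (n+2)^{c₀}` for an absolute `c₀` (here `c₀ = 3`; row sums: `n (n + 1)`
sum gates; prefix dynamic programme `E[m][t] = E[m-1][t] + R_m · E[m-1][t-1]`: `2 + 2 ⌊n/2⌋ n`
gates; `complexity_le_size`). [cite: JerrumSnir1982, §2 (elementary symmetric functions)] -/
theorem stub_esymmRowSums_complexity : ∃ c₀ : ℕ, ∀ n : ℕ,
    complexity (k := NNReal)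
      (MvPolynomial.bind₁ (fun i : Fin n => ∑ j : Fin n, MvPolynomial.X (i, j))
        (MvPolynomial.esymm (Fin n) NNReal (n / 2))) ≤ (n + 2) ^ c₀ := by
  refine ⟨3, fun n => ?_⟩
  -- the row sums `R_i = Σ_j X (i, j)`
  obtain ⟨gs₁, -, hfan₁, hlen₁, hrows⟩ := esymmRowSumsCplx_allRows (k := NNReal)
    (fun i j : Fin n => (i, j)) Finset.univ Finset.univ [] (fun g hg => absurd hg List.not_mem_nil)
  -- the dynamic programme on the multiset of row sums
  obtain ⟨gs₂, -, hfan₂, hlen₂, hdp⟩ := esymmRowSumsCplx_dp (n / 2)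
    ((Finset.univ : Finset (Fin n)).val.map
      (fun i : Fin n => ∑ j : Fin n, (MvPolynomial.X (i, j) : MvPolynomial (Fin n × Fin n) NNReal)))
    gs₁ hfan₁ (by
      intro p hp
      obtain ⟨i, -, rfl⟩ := Multiset.mem_map.mp hp
      exact hrows i (Finset.mem_univ i))
  obtain ⟨j, hj⟩ := esymmRowSumsCplx_exists_getD (hdp (n / 2) le_rfl)
  -- the circuit: gates `gs₂`, output gate `j`
  have hP : (ArithCircuit.mk gs₂ (.gate j) : ArithCircuit NNReal (Fin n × Fin n)).Computes
      (MvPolynomial.bind₁ (fun i : Fin n => ∑ j : Fin n, MvPolynomial.X (i, j))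
        (MvPolynomial.esymm (Fin n) NNReal (n / 2))) := by
    change (ArithCircuit.Operand.gate j : ArithCircuit.Operand NNReal (Fin n × Fin n)).eval
      (ArithCircuit.gateValues gs₂) = _
    rw [ArithCircuit.Operand.eval_gate, hj, ← MvPolynomial.aeval_eq_bind₁,
      MvPolynomial.aeval_esymm_eq_multiset_esymm]
  refine (ArithCircuit.complexity_le_size (P := ArithCircuit.mk gs₂ (.gate j)) hfan₂ hP).trans ?_
  change gs₂.length ≤ (n + 2) ^ 3
  simp only [List.length_nil, Finset.card_univ, Fintype.card_fin, zero_add] at hlen₁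
  simp only [Multiset.card_map, Finset.card_val, Finset.card_univ, Fintype.card_fin] at hlen₂
  have h1 : 2 * (n / 2) * n ≤ n * n := Nat.mul_le_mul_right n (Nat.mul_div_le n 2)
  have h2 : n * (n + 1) = n * n + n := by ring
  have h3 : (n * n + 4 * n + 4) * 2 ≤ (n + 2) ^ 3 := by
    have h : (n + 2) ^ 3 = (n * n + 4 * n + 4) * (n + 2) := by ring
    rw [h]
    exact Nat.mul_le_mul_left _ (by omega)
  omega

end Summit.ValiantsHypothesis.ValiantsHypothesis.Theorems

end
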